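import Summits.Schanuel.Schanuel.Theorems.DiophantineDichotomyApproximationPropertyPointAPThreeMid
import Summits.Schanuel.Schanuel.Theorems.DiophantineDichotomyApproximationPropertyPrimePartSplit
import Summits.Schanuel.Schanuel.Theorems.DiophantineDichotomyApproximationPropertySmallLowSurfaceOr
import HarnessLib

/-!
# `PointAPAbsAt 3` and the crux CONDITIONALLY on the MID-LOW-SMALL kernel only (crux `ApproximationProperty`, stmt-Schanuel-6117) — record of skeleton v27b

Crux `stmt-Schanuel-6117` (`Summit.Schanuel.Schanuel.Theses.DiophantineDichotomy.ApproximationProperty`), route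
`DiophantineDichotomy`, line `orbit-interpolation-determinant`, lead c13 (`prover-line-stmt-Schanuel-6117-c13-0`,
skeleton v27b, `Cruxes/ApproximationProperty/Lines/orbit_interpolation_determinant.lean`, KERNEL-c13.md).

This file LANDS, as real theorems with ONE explicit hypothesis (no `sorry`, no definition, no named fact), the successor
of …PointAPThreeMid.lean (p154747, hypothesis `hmid` = v25's mid stub) after two more reductions of the open kernel:
the LOW-SURFACE fact of v26 (`pointDatum_or_lowSurface3`, p155505: the satellite lies on a prime surface `Q₂` of degree
`≤ Δ/M₁` for every constant `M₁ ≥ 64c₁`) and its SMALLNESS SPLITTING of v27 (`primePartSplit3`, p159802, and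
`pointDatum_or_smallLowSurface3_of`, p162261: by Gelfond's inequality either the part of the Dirichlet form off the
satellite carries half its smallness — a datum by the envelope and Nesterenko's Prop. 4.11 with `r = 1` — or ONE prime
factor `Q₂ ∈ 𝔮'` of degree `a₂ ≤ Δ/M₁` has `‖Q₂‖_ω̄ ≤ exp(−a₂ (Δ/M₁)² λY/(3200 c₁))` and `h(Q₂) ≤ λY/c₁ + 4Δ/M₁`:
the low surface is itself a qualifying small descent surface one scale down). Hence v25's mid stub follows from the
MID-LOW-SMALL stub alone (`midSatellite3_of_midLowSmall`: run the small-low-surface dichotomy at the height scale `λ_M Y`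
and feed its second branch to the hypothesis at `λ_L Y`; boosts multiplied), and so do `PointAPAbsAt 3`, the `t = 3`
slice and — with Philippon's conjecture for `n ≥ 4` — the crux (`approximationProperty_of_midLowSmall`, registered
sub-goal). The hypothesis is the registered OPEN stub `pointDatum_of_midLowSmall3` verbatim: a long `K₀`-deficient orbit
failing the clause on a thin enveloping satellite `𝔮'` of degree `δ⋆ < deg 𝔮' < ηΔ²` lying on a SMALL cheap prime surface
of degree `≤ Δ/M₁` — the open content of Philippon's AP2 at `n = 3` in this line (KERNEL-c13.md §3).

Sources: Nesterenko–Philippon (eds.), LNM 1752 (2001) Ch. 3 §4 (Prop. 4.11), Ch. 4 §4 p. 61 (AP1/AP2); Philippon,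
Publ. Math. IHÉS 64 (1986) §3; Bombieri–Gubler (2006) §1.6 (Gelfond's inequality).
-/

set_option linter.dupNamespace false

noncomputable section

attribute [local instance] MvPolynomial.gradedAlgebra

namespace Summit.Schanuel.Schanuel.Cruxes.ApproximationProperty.OrbitInterpolationDeterminant

open Summit.Schanuel.Schanuel.Theses.DiophantineDichotomy (ApproximationProperty)
open Literature.NumberTheory.Transcendental.Nesterenko MvPolynomial
open scoped BigOperators

open PointAPThreeMid in
/-- **v25's mid stub from the MID-LOW-SMALL stub** (`midSatellite3_of_midLowSmall`, registered sub-goal): given the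
mid-low-small kernel (hypothesis = registered open stub `pointDatum_of_midLowSmall3` verbatim), v25's mid-satellite
kernel `pointDatum_of_midSatellite3` holds — take the hypothesis' `δ⋆, K₀, C₄, η, M₁`, run the landed small-low-surface
dichotomy `pointDatum_or_smallLowSurface3_of primePartSplit3` at `(C₄, M₁)` and the height scale `λ_M·Y`, and feed its
second branch to the hypothesis at the height scale `λ_L·Y` (the boosts commute). [folklore] -/
theorem midSatellite3_of_midLowSmall : (∀ (ω : Fin 3 → ℂ) (c₁ : ℝ), 1 ≤ c₁ → ∃ δstar : ℕ, 1 ≤ δstar ∧ ∃ K₀ : ℕ, 1 ≤ K₀ ∧ ∃ C₄ : ℝ, c₁ ≤ C₄ ∧ ∃ η : ℝ, 0 < η ∧ ∃ M₁ : ℝ, 64 * c₁ ≤ M₁ ∧ ∃ lam : ℝ, 1 ≤ lam ∧ ∃ c : ℝ, c₁ ≤ c ∧ ∀ Δ Y : ℝ, c ≤ Δ → Δ ≤ Y → ∀ (Q : Rx 3) (a : ℕ) (P : Rx 3) (b : ℕ) (𝔮 : Ideal (Rx 3)) (T : Rx 3) (τ : ℕ) (𝔭 𝔮' : Ideal (Rx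 3)), CycleAP3Datum ω c₁ Δ (lam * Y) Q a P b 𝔮 T τ 𝔭 → 𝔮'.IsPrime → 𝔮'.IsHomogeneous (homogeneousSubmodule (Fin (3 + 1)) ℚ) → IsUnmixedOfRank 𝔮' 2 → 𝔮' ∈ (Ideal.span {Q} ⊔ Ideal.span {P}).minimalPrimes → Ideal.span {Q} ⊔ Ideal.span {P} ⊔ Ideal.span {T} ≤ 𝔮' → 𝔮' < 𝔭 → δstar < ideg 𝔮' 2 → a + b + ⌊Δ⌋₊ ≤ τ → Module.finrank ℚ ↥(homogeneousSubmodule (Fin (3 + 1)) ℚ τ) < Module.finrank ℚ ↥(homogeneousSubmodule (Fin (3 + 1)) ℚ τ ⊓ 𝔮'.restrictScalars ℚ) + 2 * ⌊Δ⌋₊ * ideg 𝔮 2 → ⌊c₁ * Δ⌋₊ + 1 < ideg 𝔭 1 → ¬ (Module.finrank ℚ ↥(homogeneousSubmodule (Fin (3 + 1)) ℚ ⌊c₁ * Δ⌋₊) = Module.finrank ℚ ↥(homogeneousSubmodule (Fin (3 + 1)) ℚ ⌊c₁ * Δ⌋₊ ⊓ 𝔭.restrictScalars ℚ) + ideg 𝔭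 1) → homogeneousSubmodule (Fin (3 + 1)) ℚ ⌊C₄ * Δ⌋₊ ⊓ 𝔭.restrictScalars ℚ ≤ 𝔮'.restrictScalars ℚ → K₀ * Module.finrank ℚ ↥(homogeneousSubmodule (Fin (3 + 1)) ℚ ⌊C₄ * Δ⌋₊) < ideg 𝔭 1 + K₀ * Module.finrank ℚ ↥(homogeneousSubmodule (Fin (3 + 1)) ℚ ⌊C₄ * Δ⌋₊ ⊓ 𝔭.restrictScalars ℚ) → (ideg 𝔮' 2 : ℝ) < η * Δ ^ 2 → (∃ (F Q₂ : Rx 3) (d a₂ : ℕ), F ≠ 0 ∧ F.IsHomogeneous d ∧ 1 ≤ d ∧ (d : ℝ) ≤ Δ / M₁ ∧ height F ≤ lam * Y / c₁ ∧ Q₂ ≠ 0 ∧ Q₂.IsHomogeneous a₂ ∧ 1 ≤ a₂ ∧ a₂ ≤ d ∧ (Ideal.span {Q₂}).IsPrime ∧ Q₂ ∣ F ∧ Q₂ ∈ 𝔮' ∧ height Q₂ ≤ lam * Y / c₁ + 4 * Δ / M₁ ∧ normAt (Fin.cons 1 ω) Q₂ ≤ Real.exp (-((a₂ : ℝ) *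 (Δ / M₁) ^ 2 * (lam * Y) / (3200 * c₁)))) → ∃ (K : Type) (_ : Field K) (_ : NumberField K) (β : Fin 3 → K) (σ : K →+* ℂ), (Module.finrank ℚ K : ℝ) ≤ (c * Δ) ^ 3 ∧ Height.logHeight (Fin.cons (1 : K) β : Fin (3 + 1) → K) ≤ c * Y * Δ ^ 2 ∧ ‖(fun j => σ (β j)) - ω‖ ≤ Real.exp (-((Δ * Height.logHeight (Fin.cons (1 : K) β : Fin (3 + 1) → K) + Y * Module.finrank ℚ K) / c))) → ∀ (ω : Fin 3 → ℂ) (c₁ : ℝ), 1 ≤ c₁ → ∃ δstar : ℕ, 1 ≤ δstar ∧ ∃ K₀ : ℕ, 1 ≤ K₀ ∧ ∃ C₄ : ℝ, c₁ ≤ C₄ ∧ ∃ η : ℝ, 0 < η ∧ ∃ lam : ℝ, 1 ≤ lam ∧ ∃ c : ℝ, c₁ ≤ c ∧ ∀ Δ Y : ℝ, c ≤ Δ → Δ ≤ Y → ∀ (Q : Rx 3) (a : ℕ) (P : Rx 3) (b : ℕ) (𝔮 : Ideal (Rx 3)) (T : Rx 3) (τ : ℕ) (𝔭 𝔮' : Ideal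 (Rx 3)), CycleAP3Datum ω c₁ Δ (lam * Y) Q a P b 𝔮 T τ 𝔭 → 𝔮'.IsPrime → 𝔮'.IsHomogeneous (homogeneousSubmodule (Fin (3 + 1)) ℚ) → IsUnmixedOfRank 𝔮' 2 → 𝔮' ∈ (Ideal.span {Q} ⊔ Ideal.span {P}).minimalPrimes → Ideal.span {Q} ⊔ Ideal.span {P} ⊔ Ideal.span {T} ≤ 𝔮' → 𝔮' < 𝔭 → δstar < ideg 𝔮' 2 → a + b + ⌊Δ⌋₊ ≤ τ → Module.finrank ℚ ↥(homogeneousSubmodule (Fin (3 + 1)) ℚ τ) < Module.finrank ℚ ↥(homogeneousSubmodule (Fin (3 + 1)) ℚ τ ⊓ 𝔮'.restrictScalars ℚ) + 2 * ⌊Δ⌋₊ * ideg 𝔮 2 → ⌊c₁ * Δ⌋₊ + 1 < ideg 𝔭 1 → ¬ (Module.finrank ℚ ↥(homogeneousSubmodule (Fin (3 + 1)) ℚ ⌊c₁ * Δ⌋₊) = Module.finrank ℚ ↥(homogeneousSubmodule (Fin (3 + 1)) ℚ ⌊c₁ * Δ⌋₊ ⊓ 𝔭.restrictScalars ℚ)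 + ideg 𝔭 1) → homogeneousSubmodule (Fin (3 + 1)) ℚ ⌊C₄ * Δ⌋₊ ⊓ 𝔭.restrictScalars ℚ ≤ 𝔮'.restrictScalars ℚ → K₀ * Module.finrank ℚ ↥(homogeneousSubmodule (Fin (3 + 1)) ℚ ⌊C₄ * Δ⌋₊) < ideg 𝔭 1 + K₀ * Module.finrank ℚ ↥(homogeneousSubmodule (Fin (3 + 1)) ℚ ⌊C₄ * Δ⌋₊ ⊓ 𝔭.restrictScalars ℚ) → (ideg 𝔮' 2 : ℝ) < η * Δ ^ 2 → ∃ (K : Type) (_ : Field K) (_ : NumberField K) (β : Fin 3 → K) (σ : K →+* ℂ), (Module.finrank ℚ K : ℝ) ≤ (c * Δ) ^ 3 ∧ Height.logHeight (Fin.cons (1 : K) β : Fin (3 + 1) → K) ≤ c * Y * Δ ^ 2 ∧ ‖(fun j => σ (β j)) - ω‖ ≤ Real.exp (-((Δ * Height.logHeight (Fin.cons (1 : K) β : Fin (3 + 1) → K) + Y * Module.finrank ℚ K) / c)) := by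
  intro hsmall ω c₁ hc₁
  obtain ⟨δstar, hδ, K₀, hK₀, C₄, hC₄, η, hη, M₁, hM₁, lamM, hlamM, cM, hcM, hmid⟩ :=
    hsmall ω c₁ hc₁
  obtain ⟨lamL, hlamL, cL, hcL, hlow⟩ :=
    pointDatum_or_smallLowSurface3_of primePartSplit3 ω c₁ hc₁ C₄ hC₄ M₁ hM₁
  have hcM0 : 0 < cM := by linarith
  have hcL0 : 0 < cL := by linarith
  have hc₁0 : 0 < c₁ := by linarith
  refine ⟨δstar, hδ, K₀, hK₀, C₄, hC₄, η, hη, lamM * lamL, one_le_mul_of_one_le_of_one_le hlamM hlamL,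
    max (cM * lamL) (cL * lamM), ?_, ?_⟩
  · exact le_trans hcM (le_trans (le_mul_of_one_le_right hcM0.le hlamL) (le_max_left _ _))
  intro Δ Y hΔ hY Q a P b 𝔮 T τ 𝔭 𝔮' hdat h1 h2 h3 h4 h5 h6 h7 h8 h9 h10 h11 h12 h13 hcase
  have hcMΔ : cM ≤ Δ := le_trans (le_trans (le_mul_of_one_le_right hcM0.le hlamL) (le_max_left _ _)) hΔ
  have hcLΔ : cL ≤ Δ := le_trans (le_trans (le_mul_of_one_le_right hcL0.le hlamM) (le_max_right _ _)) hΔ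
  have hΔ0 : 0 ≤ Δ := by linarith
  have hY0 : 0 ≤ Y := by linarith
  -- the small-low-surface dichotomy at the height scale `lamM * Y`
  have hY₁ : Δ ≤ lamM * Y := le_trans hY (le_mul_of_one_le_left hY0 hlamM)
  have hdat₁ : CycleAP3Datum ω c₁ Δ (lamL * (lamM * Y)) Q a P b 𝔮 T τ 𝔭 := by
    rw [show lamL * (lamM * Y) = lamM * lamL * Y by ring]; exact hdat
  rcases hlow Δ (lamM * Y) hcLΔ hY₁ Q a P b 𝔮 T τ 𝔭 𝔮' hdat₁ h1 h3 h6.le h12 with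
    ⟨K, iF, iN, β, σ, hd, hh, hacc⟩ |
    ⟨F, Q₂, d, a₂, hF0, hFhom, hd1, hdM, hFh, hQ₂0, hQ₂hom, ha₂1, ha₂d, hQ₂p, hdvd, hQ₂𝔮', hQ₂h, hQ₂small⟩
  · refine ⟨K, iF, iN, β, σ, ?_, ?_, ?_⟩
    · exact hd.trans (pow_le_pow_left₀ (by positivity)
        (mul_le_mul_of_nonneg_right (le_trans (le_mul_of_one_le_right hcL0.le hlamM) (le_max_right _ _)) hΔ0) 3)
    · calc _ ≤ cL * (lamM * Y) * Δ ^ 2 := hh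
        _ = (cL * lamM) * Y * Δ ^ 2 := by ring
        _ ≤ max (cM * lamL) (cL * lamM) * Y * Δ ^ 2 := by gcongr; exact le_max_right _ _
    · exact hacc.trans (PointAPThreeMid.exp_datum_mono (Height.logHeight_nonneg _) (Nat.cast_nonneg _) hΔ0 hY0
        (le_mul_of_one_le_left hY0 hlamM) hcL0
        (le_trans (le_mul_of_one_le_right hcL0.le hlamM) (le_max_right _ _)))
  · -- the mid-low-small stub at the height scale `lamL * Y`
    have hY₂ : Δ ≤ lamL * Y := le_trans hY (le_mul_of_one_le_left hY0 hlamL)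
    have hdat₂ : CycleAP3Datum ω c₁ Δ (lamM * (lamL * Y)) Q a P b 𝔮 T τ 𝔭 := by
      rw [show lamM * (lamL * Y) = lamM * lamL * Y by ring]; exact hdat
    have hFh₂ : height F ≤ lamM * (lamL * Y) / c₁ := by
      rw [show lamM * (lamL * Y) / c₁ = lamL * (lamM * Y) / c₁ by ring]; exact hFh
    have hQ₂h₂ : height Q₂ ≤ lamM * (lamL * Y) / c₁ + 4 * Δ / M₁ := by
      rw [show lamM * (lamL * Y) / c₁ = lamL * (lamM * Y) / c₁ by ring]; exact hQ₂h
    have hQ₂small₂ : normAt (Fin.cons 1 ω) Q₂ ≤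
        Real.exp (-((a₂ : ℝ) * (Δ / M₁) ^ 2 * (lamM * (lamL * Y)) / (3200 * c₁))) := by
      rw [show lamM * (lamL * Y) = lamL * (lamM * Y) by ring]; exact hQ₂small
    obtain ⟨K, iF, iN, β, σ, hd, hh, hacc⟩ :=
      hmid Δ (lamL * Y) hcMΔ hY₂ Q a P b 𝔮 T τ 𝔭 𝔮' hdat₂ h1 h2 h3 h4 h5 h6 h7 h8 h9 h10 h11 h12 h13 hcase
        ⟨F, Q₂, d, a₂, hF0, hFhom, hd1, hdM, hFh₂, hQ₂0, hQ₂hom, ha₂1, ha₂d, hQ₂p, hdvd, hQ₂𝔮', hQ₂h₂, hQ₂small₂⟩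
    refine ⟨K, iF, iN, β, σ, ?_, ?_, ?_⟩
    · exact hd.trans (pow_le_pow_left₀ (by positivity)
        (mul_le_mul_of_nonneg_right (le_trans (le_mul_of_one_le_right hcM0.le hlamL) (le_max_left _ _)) hΔ0) 3)
    · calc _ ≤ cM * (lamL * Y) * Δ ^ 2 := hh
        _ = (cM * lamL) * Y * Δ ^ 2 := by ring
        _ ≤ max (cM * lamL) (cL * lamM) * Y * Δ ^ 2 := by gcongr; exact le_max_left _ _
    · exact hacc.trans (PointAPThreeMid.exp_datum_mono (Height.logHeight_nonneg _) (Nat.cast_nonneg _) hΔ0 hY0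
        (le_mul_of_one_le_left hY0 hlamL) hcM0
        (le_trans (le_mul_of_one_le_right hcM0.le hlamL) (le_max_left _ _)))

/-- **`PointAPAbsAt 3` from the mid-low-small kernel** (landed `pointAPAt3_of_mid` over `midSatellite3_of_midLowSmall`).
[folklore] -/
theorem pointAPAt3_of_midLowSmall : (∀ (ω : Fin 3 → ℂ) (c₁ : ℝ), 1 ≤ c₁ → ∃ δstar : ℕ, 1 ≤ δstar ∧ ∃ K₀ : ℕ, 1 ≤ K₀ ∧ ∃ C₄ : ℝ, c₁ ≤ C₄ ∧ ∃ η : ℝ, 0 < η ∧ ∃ M₁ : ℝ, 64 * c₁ ≤ M₁ ∧ ∃ lam : ℝ, 1 ≤ lam ∧ ∃ c : ℝ, c₁ ≤ c ∧ ∀ Δ Y : ℝ, c ≤ Δ → Δ ≤ Y → ∀ (Q : Rx 3) (a : ℕ) (P : Rx 3) (b : ℕ) (𝔮 : Ideal (Rx 3)) (T : Rx 3) (τ : ℕ) (𝔭 𝔮' : Ideal (Rx 3)), CycleAP3Datum ω c₁ Δ (lam * Y) Q a P b 𝔮 T τ 𝔭 → 𝔮'.IsPrime → 𝔮'.IsHomogeneous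 (homogeneousSubmodule (Fin (3 + 1)) ℚ) → IsUnmixedOfRank 𝔮' 2 → 𝔮' ∈ (Ideal.span {Q} ⊔ Ideal.span {P}).minimalPrimes → Ideal.span {Q} ⊔ Ideal.span {P} ⊔ Ideal.span {T} ≤ 𝔮' → 𝔮' < 𝔭 → δstar < ideg 𝔮' 2 → a + b + ⌊Δ⌋₊ ≤ τ → Module.finrank ℚ ↥(homogeneousSubmodule (Fin (3 + 1)) ℚ τ) < Module.finrank ℚ ↥(homogeneousSubmodule (Fin (3 + 1)) ℚ τ ⊓ 𝔮'.restrictScalars ℚ) + 2 * ⌊Δ⌋₊ * ideg 𝔮 2 → ⌊c₁ * Δ⌋₊ + 1 < ideg 𝔭 1 → ¬ (Module.finrank ℚ ↥(homogeneousSubmodule (Fin (3 + 1)) ℚ ⌊c₁ * Δ⌋₊) = Module.finrank ℚ ↥(homogeneousSubmodule (Fin (3 + 1)) ℚ ⌊c₁ * Δ⌋₊ ⊓ 𝔭.restrictScalars ℚ) + ideg 𝔭 1) → homogeneousSubmodule (Fin (3 + 1)) ℚ ⌊C₄ * Δ⌋₊ ⊓ 𝔭.restrictScalars ℚ ≤ 𝔮'.restrictScalars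 ℚ → K₀ * Module.finrank ℚ ↥(homogeneousSubmodule (Fin (3 + 1)) ℚ ⌊C₄ * Δ⌋₊) < ideg 𝔭 1 + K₀ * Module.finrank ℚ ↥(homogeneousSubmodule (Fin (3 + 1)) ℚ ⌊C₄ * Δ⌋₊ ⊓ 𝔭.restrictScalars ℚ) → (ideg 𝔮' 2 : ℝ) < η * Δ ^ 2 → (∃ (F Q₂ : Rx 3) (d a₂ : ℕ), F ≠ 0 ∧ F.IsHomogeneous d ∧ 1 ≤ d ∧ (d : ℝ) ≤ Δ / M₁ ∧ height F ≤ lam * Y / c₁ ∧ Q₂ ≠ 0 ∧ Q₂.IsHomogeneous a₂ ∧ 1 ≤ a₂ ∧ a₂ ≤ d ∧ (Ideal.span {Q₂}).IsPrime ∧ Q₂ ∣ F ∧ Q₂ ∈ 𝔮' ∧ height Q₂ ≤ lam * Y / c₁ + 4 * Δ / M₁ ∧ normAt (Fin.cons 1 ω) Q₂ ≤ Real.exp (-((a₂ : ℝ) * (Δ / M₁) ^ 2 * (lam * Y) / (3200 * c₁)))) → ∃ (K : Type) (_ : Field K) (_ : NumberField K) (β : Fin 3 → K) (σ : K →+* ℂ),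 (Module.finrank ℚ K : ℝ) ≤ (c * Δ) ^ 3 ∧ Height.logHeight (Fin.cons (1 : K) β : Fin (3 + 1) → K) ≤ c * Y * Δ ^ 2 ∧ ‖(fun j => σ (β j)) - ω‖ ≤ Real.exp (-((Δ * Height.logHeight (Fin.cons (1 : K) β : Fin (3 + 1) → K) + Y * Module.finrank ℚ K) / c))) → PointAPAbsAt 3 :=
  fun hsmall => pointAPAt3_of_mid (midSatellite3_of_midLowSmall hsmall)

/-- **The `t = 3` slice of the crux from the mid-low-small kernel ALONE** (landed `slice_three_of_mid`). [folklore] -/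
theorem slice_three_of_midLowSmall : (∀ (ω : Fin 3 → ℂ) (c₁ : ℝ), 1 ≤ c₁ → ∃ δstar : ℕ, 1 ≤ δstar ∧ ∃ K₀ : ℕ, 1 ≤ K₀ ∧ ∃ C₄ : ℝ, c₁ ≤ C₄ ∧ ∃ η : ℝ, 0 < η ∧ ∃ M₁ : ℝ, 64 * c₁ ≤ M₁ ∧ ∃ lam : ℝ, 1 ≤ lam ∧ ∃ c : ℝ, c₁ ≤ c ∧ ∀ Δ Y : ℝ, c ≤ Δ → Δ ≤ Y → ∀ (Q : Rx 3) (a : ℕ) (P : Rx 3) (b : ℕ) (𝔮 : Ideal (Rx 3)) (T : Rx 3) (τ : ℕ) (𝔭 𝔮' : Ideal (Rx 3)), CycleAP3Datum ω c₁ Δ (lam * Y) Q a P b 𝔮 T τ 𝔭 → 𝔮'.IsPrime → 𝔮'.IsHomogeneous (homogeneousSubmodule (Fin (3 + 1)) ℚ) → IsUnmixedOfRank 𝔮' 2 → 𝔮' ∈ (Ideal.span {Q} ⊔ Ideal.span {P}).minimalPrimes → Ideal.span {Q} ⊔ Ideal.span {P} ⊔ Ideal.span {T} ≤ 𝔮'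 → 𝔮' < 𝔭 → δstar < ideg 𝔮' 2 → a + b + ⌊Δ⌋₊ ≤ τ → Module.finrank ℚ ↥(homogeneousSubmodule (Fin (3 + 1)) ℚ τ) < Module.finrank ℚ ↥(homogeneousSubmodule (Fin (3 + 1)) ℚ τ ⊓ 𝔮'.restrictScalars ℚ) + 2 * ⌊Δ⌋₊ * ideg 𝔮 2 → ⌊c₁ * Δ⌋₊ + 1 < ideg 𝔭 1 → ¬ (Module.finrank ℚ ↥(homogeneousSubmodule (Fin (3 + 1)) ℚ ⌊c₁ * Δ⌋₊) = Module.finrank ℚ ↥(homogeneousSubmodule (Fin (3 + 1)) ℚ ⌊c₁ * Δ⌋₊ ⊓ 𝔭.restrictScalars ℚ) + ideg 𝔭 1) → homogeneousSubmodule (Fin (3 + 1)) ℚ ⌊C₄ * Δ⌋₊ ⊓ 𝔭.restrictScalars ℚ ≤ 𝔮'.restrictScalars ℚ → K₀ * Module.finrank ℚ ↥(homogeneousSubmodule (Fin (3 + 1)) ℚ ⌊C₄ * Δ⌋₊) < ideg 𝔭 1 + K₀ * Module.finrank ℚ ↥(homogeneousSubmodule (Fin (3 + 1)) ℚ ⌊C₄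 * Δ⌋₊ ⊓ 𝔭.restrictScalars ℚ) → (ideg 𝔮' 2 : ℝ) < η * Δ ^ 2 → (∃ (F Q₂ : Rx 3) (d a₂ : ℕ), F ≠ 0 ∧ F.IsHomogeneous d ∧ 1 ≤ d ∧ (d : ℝ) ≤ Δ / M₁ ∧ height F ≤ lam * Y / c₁ ∧ Q₂ ≠ 0 ∧ Q₂.IsHomogeneous a₂ ∧ 1 ≤ a₂ ∧ a₂ ≤ d ∧ (Ideal.span {Q₂}).IsPrime ∧ Q₂ ∣ F ∧ Q₂ ∈ 𝔮' ∧ height Q₂ ≤ lam * Y / c₁ + 4 * Δ / M₁ ∧ normAt (Fin.cons 1 ω) Q₂ ≤ Real.exp (-((a₂ : ℝ) * (Δ / M₁) ^ 2 * (lam * Y) / (3200 * c₁)))) → ∃ (K : Type) (_ : Field K) (_ : NumberField K) (β : Fin 3 → K) (σ : K →+* ℂ), (Module.finrank ℚ K : ℝ) ≤ (c * Δ) ^ 3 ∧ Height.logHeight (Fin.cons (1 : K) β : Fin (3 + 1) → K) ≤ c * Y * Δ ^ 2 ∧ ‖(fun j => σ (β j)) - ω‖ ≤ Real.exp (-((Δ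 * Height.logHeight (Fin.cons (1 : K) β : Fin (3 + 1) → K) + Y * Module.finrank ℚ K) / c))) → PointwiseAPSlice 3 :=
  fun hsmall => slice_three_of_mid (midSatellite3_of_midLowSmall hsmall)

/-- **The crux from the mid-low-small kernel and Philippon's conjecture for `n ≥ 4`** (registered sub-goal
`approximationProperty_of_midLowSmall`; landed `approximationProperty_of_mid`): skeleton v27b's composition as a theorem
of the tree — `ApproximationProperty` follows from the two registered OPEN stubs `pointDatum_of_midLowSmall3` and
`stub_pointAP_four_le`, and from nothing else. [folklore] -/
theorem approximationProperty_of_midLowSmall : (∀ (ω : Fin 3 → ℂ) (c₁ : ℝ), 1 ≤ c₁ → ∃ δstar : ℕ, 1 ≤ δstar ∧ ∃ K₀ : ℕ, 1 ≤ K₀ ∧ ∃ C₄ : ℝ, c₁ ≤ C₄ ∧ ∃ η : ℝ, 0 < η ∧ ∃ M₁ : ℝ, 64 * c₁ ≤ M₁ ∧ ∃ lam : ℝ, 1 ≤ lam ∧ ∃ c : ℝ, c₁ ≤ c ∧ ∀ Δ Y : ℝ, c ≤ Δ → Δ ≤ Y → ∀ (Q : Rx 3) (a : ℕ) (P : Rx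 3) (b : ℕ) (𝔮 : Ideal (Rx 3)) (T : Rx 3) (τ : ℕ) (𝔭 𝔮' : Ideal (Rx 3)), CycleAP3Datum ω c₁ Δ (lam * Y) Q a P b 𝔮 T τ 𝔭 → 𝔮'.IsPrime → 𝔮'.IsHomogeneous (homogeneousSubmodule (Fin (3 + 1)) ℚ) → IsUnmixedOfRank 𝔮' 2 → 𝔮' ∈ (Ideal.span {Q} ⊔ Ideal.span {P}).minimalPrimes → Ideal.span {Q} ⊔ Ideal.span {P} ⊔ Ideal.span {T} ≤ 𝔮' → 𝔮' < 𝔭 → δstar < ideg 𝔮' 2 → a + b + ⌊Δ⌋₊ ≤ τ → Module.finrank ℚ ↥(homogeneousSubmodule (Fin (3 + 1)) ℚ τ) < Module.finrank ℚ ↥(homogeneousSubmodule (Fin (3 + 1)) ℚ τ ⊓ 𝔮'.restrictScalars ℚ) + 2 * ⌊Δ⌋₊ * ideg 𝔮 2 → ⌊c₁ * Δ⌋₊ + 1 < ideg 𝔭 1 → ¬ (Module.finrank ℚ ↥(homogeneousSubmodule (Fin (3 + 1)) ℚ ⌊c₁ * Δ⌋₊) = Module.finrank ℚ ↥(homogeneousSubmodule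 (Fin (3 + 1)) ℚ ⌊c₁ * Δ⌋₊ ⊓ 𝔭.restrictScalars ℚ) + ideg 𝔭 1) → homogeneousSubmodule (Fin (3 + 1)) ℚ ⌊C₄ * Δ⌋₊ ⊓ 𝔭.restrictScalars ℚ ≤ 𝔮'.restrictScalars ℚ → K₀ * Module.finrank ℚ ↥(homogeneousSubmodule (Fin (3 + 1)) ℚ ⌊C₄ * Δ⌋₊) < ideg 𝔭 1 + K₀ * Module.finrank ℚ ↥(homogeneousSubmodule (Fin (3 + 1)) ℚ ⌊C₄ * Δ⌋₊ ⊓ 𝔭.restrictScalars ℚ) → (ideg 𝔮' 2 : ℝ) < η * Δ ^ 2 → (∃ (F Q₂ : Rx 3) (d a₂ : ℕ), F ≠ 0 ∧ F.IsHomogeneous d ∧ 1 ≤ d ∧ (d : ℝ) ≤ Δ / M₁ ∧ height F ≤ lam * Y / c₁ ∧ Q₂ ≠ 0 ∧ Q₂.IsHomogeneous a₂ ∧ 1 ≤ a₂ ∧ a₂ ≤ d ∧ (Ideal.span {Q₂}).IsPrime ∧ Q₂ ∣ F ∧ Q₂ ∈ 𝔮' ∧ height Q₂ ≤ lam * Y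 / c₁ + 4 * Δ / M₁ ∧ normAt (Fin.cons 1 ω) Q₂ ≤ Real.exp (-((a₂ : ℝ) * (Δ / M₁) ^ 2 * (lam * Y) / (3200 * c₁)))) → ∃ (K : Type) (_ : Field K) (_ : NumberField K) (β : Fin 3 → K) (σ : K →+* ℂ), (Module.finrank ℚ K : ℝ) ≤ (c * Δ) ^ 3 ∧ Height.logHeight (Fin.cons (1 : K) β : Fin (3 + 1) → K) ≤ c * Y * Δ ^ 2 ∧ ‖(fun j => σ (β j)) - ω‖ ≤ Real.exp (-((Δ * Height.logHeight (Fin.cons (1 : K) β : Fin (3 + 1) → K) + Y * Module.finrank ℚ K) / c))) → (∀ t : ℕ, 4 ≤ t → PointAPAbsAt t) → ApproximationProperty :=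
  fun hsmall h4 => approximationProperty_of_mid (midSatellite3_of_midLowSmall hsmall) h4

end Summit.Schanuel.Schanuel.Cruxes.ApproximationProperty.OrbitInterpolationDeterminant

end
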